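import Summits.BirchSwinnertonDyer.BirchSwinnertonDyer.Theorems.CumulativeHeegnerLeopoldtCumulativeHeegnerInclusionAtThreeUnrSeriesZeros
import Summits.BirchSwinnertonDyer.BirchSwinnertonDyer.Theorems.CongruentShaFreeCutPadicSupplyRate
import Mathlib.Topology.Algebra.Polynomial
import HarnessLib

/-!
# Crux K1 `CumulativeHeegnerInclusionAtThree` (stmt-BirchSwinnertonDyer-24198), line `birth` — STUB A
# (`TemperedHeegnerInclusionAtThree`, crux 26896): the VALUES CURRENCY of the conclusion
# `∃ μ, (3^μ · L) ⊆ (g)` in `Λ^ur = R₀⟦T⟧` — divisibility up to a power of `p` ⟺ pointwise norm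
# domination `‖L(x)‖ ≤ C·‖g(x)‖` on the open unit disc of `ℂ_p`

Width seat bsd-line-chl-k1-p1-w2 (`--supports stmt-BirchSwinnertonDyer-24198`), sequel of `…UnrSeriesZeros`.

Stub A of the line (= child crux stmt-BirchSwinnertonDyer-26896) concludes
`∃ μ : ℕ, Ideal.span {(3 : UnrSeries 3) ^ μ * L} ≤ (Ch_Λ X).map (PowerSeries.map toUnr)`, i.e. a
DIVISIBILITY `g ∣ p^μ · L` in `R₀⟦T⟧` for a generator `g` of the (principal on the cell: stub B) image of
the characteristic ideal. Every Euler/Kolyvagin-system argument delivers its bound SPECIALISATION BY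
SPECIALISATION (Mazur–Rubin Thm. 5.3.10; Howard 2004 §2): at a height-one prime `𝔓 = (P)` of `Λ`, i.e. at
a point `x` of the open unit disc (a root of the distinguished polynomial `P`), one gets
`length_{𝒪_x}(X ⊗ 𝒪_x) ≤ ord_x L(x) + c` with `c` independent of `x`, which for a torsion module of
characteristic power series `g` reads `‖L(x)‖ ≤ p^c · ‖g(x)‖`. This file proves, for every prime `p`, that
this pointwise currency IS the currency of stub A:

* §1 norms of values (`‖L(x)‖ ≤ 1` on the open disc is the tree's `…PadicSupplyRate.norm_value_le_one`):
  `‖U(x)‖ = 1` for a unit `U` (`norm_value_eq_one_of_isUnit`); the maximal ideal `(p)` of `R₀` has norm `< 1`.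
* §2 polynomials over `ℂ_p`: the roots of a monic polynomial whose lower coefficients have norm `< 1` lie
  in the open unit disc (`norm_root_lt_one`); a polynomial of degree `< d` dominated on the open disc by
  `C · ∏_{i<d} ‖x − α_i‖` (`‖α_i‖ < 1`) is ZERO (`eq_zero_of_norm_eval_le_prod`: root by root, the bound
  at a removed root being recovered by continuity — the open disc minus a finite set is dense in it,
  `mem_closure_disc_diff_finite`).
* §3 **`exists_C_pow_mul_mem_span_of_norm_value_le`**: for `g ≠ 0` and `L` in `R₀⟦T⟧`, if
  `‖L(x)‖ ≤ C · ‖g(x)‖` at every point `x` of a subset `S` of the open disc whose closure contains the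
  disc (e.g. all points, or all but finitely many: `…_of_finite`), then `p^μ · L ∈ (g)` for some `μ`
  (`p`-content + Weierstrass preparation `g = p^a · P · U` over the complete DVR `R₀` — tree
  `isDiscreteValuationRing_unrIntegers`, `isAdicComplete_maximalIdeal`, Mathlib
  `exists_isWeierstrassFactorization` —, Weierstrass DIVISION `L = (P U) q + r` (Mathlib
  `exists_isWeierstrassDivision`), `‖r(x)‖ ≤ C' ‖P(x)‖`, `P` splits in the algebraically closed `ℂ_p` with
  all roots in the disc, §2 kills `r`, and `μ = a`); the CONVERSE `norm_value_le_of_C_pow_mul_mem_span`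
  (`p^μ L = q g ⟹ ‖L(x)‖ ≤ p^μ ‖g(x)‖`); the packaging **`exists_C_pow_mul_mem_span_iff_norm_value_le`**
  (divisibility up to `p^μ` ⟺ uniform domination on the disc) and the stub-A-shaped corollary
  `exists_span_pow_mul_le_of_norm_value_le` (`∃ μ, span{p^μ · L} ≤ J` for any ideal `J ∋ g`).

Companion `…UnrSeriesTorsionDomination`: domination at the TORSION points `ζ − 1` (finite-order characters)
alone does NOT give divisibility (`g = T − p²`, `L = 1`) — a divisibility in `Λ^ur` needs the bound on a
dense set of specialisations, not only where Liu–Zhang–Zhang is printed.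

HONEST FRAMING: pure `p`-adic algebra on `R₀⟦T⟧`; nothing about elliptic curves, Selmer groups or
`L`-functions is asserted; closes nothing by itself (the Kolyvagin-system bound at additive `3` with
reducible `E[3]` — crux 26896 — is not in print). No definition, no named fact, no `sorry`. BSD is not
proved by any of this. References: [Washington1997] §7.1 Prop. 7.2, Thm. 7.3; [Lang1990] Ch. 5 §2;
[MazurRubin2004] Thm. 5.3.10, [Howard2004] §2.2; route CumulativeHeegnerLeopoldt TWO-LAYER PLAN (c).
-/

set_option autoImplicit false
-- `…BirchSwinnertonDyer.BirchSwinnertonDyer.Theorems…` is the problem's mandated namespace (D-0017).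
set_option linter.dupNamespace false

noncomputable section

open scoped Classical

open Filter Topology PowerSeries Literature.NumberTheory.EllipticCurves
  Summit.BirchSwinnertonDyer.Rank1Residual.X11b.Halves
  Summit.BirchSwinnertonDyer.Rank1Residual.X2.HidaLimitAlgebra
  Summit.BirchSwinnertonDyer.BirchSwinnertonDyer.Theorems.CongruentShaFreeCutUnrSeriesWeierstrass
  Summit.BirchSwinnertonDyer.BirchSwinnertonDyer.Theorems.CumulativeHeegnerInclusionAtThreeUnrSeriesZeros

open Summit.BirchSwinnertonDyer.BirchSwinnertonDyer.Theorems.CongruentShaFreeCutBDPUpToPowerMapIdentity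
  (hasValueAt_sub hasValueAt_add)
open Summit.BirchSwinnertonDyer.BirchSwinnertonDyer.Theorems.CongruentShaFreeCutPadicSupplyRate
  (norm_value_le_one)

namespace Summit.BirchSwinnertonDyer.BirchSwinnertonDyer.Theorems.CumulativeHeegnerInclusionAtThreeUnrSeriesDomination

variable {p : ℕ} [hp : Fact p.Prime]

/-! ### §1 Norms of values of elements of `R₀⟦T⟧` on the open unit disc -/

/-- **A unit `U` of `R₀⟦T⟧` has `‖U(x)‖ = 1`** at every `‖x‖ < 1` (`U(x) · U⁻¹(x) = 1` with both factors of
norm `≤ 1`, tree `…PadicSupplyRate.norm_value_le_one`). [cite: Washington1997, §7.1] -/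
theorem norm_value_eq_one_of_isUnit {U : UnrSeries p} (hU : IsUnit U) {x u : ℂ_[p]} (hx : ‖x‖ < 1)
    (hu : U.HasValueAt x u) : ‖u‖ = 1 := by
  obtain ⟨V, hV⟩ := hU.exists_right_inv
  obtain ⟨w, hw⟩ := exists_hasValueAt V hx
  have h1 : UnrSeries.HasValueAt (U * V) x (u * w) := hasValueAt_mul hx hu hw
  rw [hV] at h1
  have h2 : u * w = 1 := h1.unique (hasValueAt_one x)
  have h3 : ‖u‖ * ‖w‖ = 1 := by rw [← norm_mul, h2, norm_one]
  refine le_antisymm (norm_value_le_one hx hu) ?_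
  nlinarith [norm_nonneg u, norm_nonneg w, norm_value_le_one hx hu, norm_value_le_one hx hw]

/-- Elements of the maximal ideal `(p)` of the DVR `R₀` have norm `< 1` in `ℂ_p`.
[cite: Washington1997, §7.1] -/
theorem norm_lt_one_of_mem_maximalIdeal {c : unrIntegers p}
    (hc : (haveI := isDiscreteValuationRing_unrIntegers (p := p);
      c ∈ IsLocalRing.maximalIdeal (unrIntegers p))) : ‖(c : ℂ_[p])‖ < 1 := by
  haveI := isDiscreteValuationRing_unrIntegers (p := p)
  have hc' : c ∈ Ideal.span {((p : ℕ) : unrIntegers p)} := by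
    rw [← maximalIdeal_eq_span_p]; exact hc
  obtain ⟨d, rfl⟩ := Ideal.mem_span_singleton'.mp hc'
  rw [Subring.coe_mul, norm_mul]
  calc ‖(d : ℂ_[p])‖ * ‖(((p : ℕ) : unrIntegers p) : ℂ_[p])‖
      ≤ 1 * ‖(((p : ℕ) : unrIntegers p) : ℂ_[p])‖ := by
        gcongr; exact norm_coe_unrIntegers_le_one p d
    _ < 1 := by
        rw [one_mul]
        exact norm_prime_padicComplex_lt_one

/-! ### §2 Polynomials over `ℂ_p`: roots in the disc; domination by `∏ ‖x − α_i‖` kills low degree -/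

/-- **The roots of a monic polynomial over `ℂ_p` whose non-leading coefficients have norm `< 1` lie in
the open unit disc** (if `‖α‖ ≥ 1` the leading term `α^d` dominates). Applies to the image in `ℂ_p[T]` of
a distinguished polynomial of `R₀[T]`. [cite: Washington1997, §7.1] -/
theorem norm_root_lt_one {P : Polynomial ℂ_[p]} (hmo : P.Monic)
    (hc : ∀ k < P.natDegree, ‖P.coeff k‖ < 1) {α : ℂ_[p]} (hα : P.IsRoot α) : ‖α‖ < 1 := by
  by_contra hge
  rw [not_lt] at hge
  have hα' : ∑ k ∈ Finset.range P.natDegree, P.coeff k * α ^ k + α ^ P.natDegree = 0 := by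
    rwa [Polynomial.IsRoot.def, Polynomial.eval_eq_sum_range, Finset.sum_range_succ,
      hmo.coeff_natDegree, one_mul] at hα
  rcases Nat.eq_zero_or_pos P.natDegree with hd | hd
  · rw [hd, Finset.sum_range_zero, pow_zero, zero_add] at hα'
    exact one_ne_zero hα'
  · obtain ⟨s, hs1, hs⟩ : ∃ s : ℝ, s < 1 ∧ ∀ k ∈ Finset.range P.natDegree, ‖P.coeff k‖ ≤ s := by
      refine ⟨(Finset.range P.natDegree).sup' ⟨0, by simpa using hd⟩ (fun k ↦ ‖P.coeff k‖), ?_,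
        fun k hk ↦ Finset.le_sup' (fun k ↦ ‖P.coeff k‖) hk⟩
      exact (Finset.sup'_lt_iff _).mpr fun k hk ↦ hc k (Finset.mem_range.mp hk)
    have hs0 : 0 ≤ s := (norm_nonneg _).trans (hs 0 (by simpa using hd))
    have hbound : ‖∑ k ∈ Finset.range P.natDegree, P.coeff k * α ^ k‖ ≤ s * ‖α‖ ^ P.natDegree := by
      refine IsUltrametricDist.norm_sum_le_of_forall_le_of_nonneg (by positivity) fun k hk ↦ ?_
      have hk' : k < P.natDegree := Finset.mem_range.mp hk
      rw [norm_mul, norm_pow]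
      exact mul_le_mul (hs k hk) (pow_le_pow_right₀ hge hk'.le) (by positivity) hs0
    have heq : α ^ P.natDegree = -∑ k ∈ Finset.range P.natDegree, P.coeff k * α ^ k :=
      eq_neg_of_add_eq_zero_right hα'
    have hle : ‖α‖ ^ P.natDegree ≤ s * ‖α‖ ^ P.natDegree := by
      calc ‖α‖ ^ P.natDegree = ‖α ^ P.natDegree‖ := (norm_pow _ _).symm
        _ = ‖∑ k ∈ Finset.range P.natDegree, P.coeff k * α ^ k‖ := by rw [heq, norm_neg]
        _ ≤ s * ‖α‖ ^ P.natDegree := hbound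
    have hpos : 0 < ‖α‖ ^ P.natDegree := pow_pos (lt_of_lt_of_le one_pos hge) _
    nlinarith

/-- **The open unit disc of `ℂ_p` minus a finite set is dense in the disc**: every `a` with `‖a‖ < 1` is
the limit of `a + p^{n+1}`, and only finitely many of these lie in the finite set `F`. [folklore] -/
theorem mem_closure_disc_diff_finite {F : Set ℂ_[p]} (hF : F.Finite) {a : ℂ_[p]} (ha : ‖a‖ < 1) :
    a ∈ closure {x : ℂ_[p] | ‖x‖ < 1 ∧ x ∉ F} := by
  have hp0 : (p : ℂ_[p]) ≠ 0 := by exact_mod_cast hp.out.ne_zero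
  have hplt : ‖(p : ℂ_[p])‖ < 1 := norm_prime_padicComplex_lt_one
  set u : ℕ → ℂ_[p] := fun n ↦ a + (p : ℂ_[p]) ^ (n + 1) with hu
  have hten : Tendsto u atTop (𝓝 a) := by
    have h0 : Tendsto (fun n : ℕ ↦ (p : ℂ_[p]) ^ (n + 1)) atTop (𝓝 0) :=
      (tendsto_pow_atTop_nhds_zero_of_norm_lt_one hplt).comp (tendsto_add_atTop_nat 1)
    simpa using tendsto_const_nhds.add h0
  refine mem_closure_of_tendsto hten ?_
  -- `u` is injective, so only finitely many `u n` lie in `F`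
  have hinj : Function.Injective u := by
    intro m n hmn
    have h1 : (p : ℂ_[p]) ^ (m + 1) = (p : ℂ_[p]) ^ (n + 1) := add_left_cancel hmn
    have h2 : ‖(p : ℂ_[p])‖ ^ (m + 1) = ‖(p : ℂ_[p])‖ ^ (n + 1) := by
      rw [← norm_pow, ← norm_pow, h1]
    have h3 := pow_right_injective₀ (norm_pos_iff.mpr hp0) hplt.ne h2
    omega
  have hfin : {n : ℕ | u n ∈ F}.Finite := hF.preimage hinj.injOn
  have hev : ∀ᶠ n in atTop, u n ∉ F := by
    rw [← Nat.cofinite_eq_atTop]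
    exact hfin.compl_mem_cofinite
  filter_upwards [hev] with n hn
  refine ⟨?_, hn⟩
  calc ‖a + (p : ℂ_[p]) ^ (n + 1)‖ ≤ max ‖a‖ ‖(p : ℂ_[p]) ^ (n + 1)‖ :=
        IsUltrametricDist.norm_add_le_max _ _
    _ < 1 := max_lt ha (by rw [norm_pow]; exact pow_lt_one₀ (norm_nonneg _) hplt (by omega))

/-- A pointwise domination `‖r(x)‖ ≤ C · ‖Q(x)‖` between two polynomials over `ℂ_p` on a set `A` extends
to the closure of `A` (polynomial maps are continuous). [folklore] -/
theorem norm_eval_le_on_closure {r Q : Polynomial ℂ_[p]} {C : ℝ} {A : Set ℂ_[p]}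
    (h : ∀ x ∈ A, ‖r.eval x‖ ≤ C * ‖Q.eval x‖) {x : ℂ_[p]} (hx : x ∈ closure A) :
    ‖r.eval x‖ ≤ C * ‖Q.eval x‖ :=
  le_on_closure (f := fun y ↦ ‖r.eval y‖) (g := fun y ↦ C * ‖Q.eval y‖) h
    r.continuous.norm.continuousOn (continuous_const.mul Q.continuous.norm).continuousOn hx

/-- **A polynomial of degree `< d` dominated on the open unit disc by `C · ∏_{i<d} ‖x − α_i‖` with all
`‖α_i‖ < 1` is zero**: at `x = α_1` it vanishes, so `r = (T − α_1) r_1`; off `α_1` the quotient `r_1` is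
dominated by the remaining product, at `α_1` too by continuity and density; induct on `d`.
[cite: Washington1997, §7.1] -/
theorem eq_zero_of_norm_eval_le_prod {C : ℝ} (s : Multiset ℂ_[p]) (hs : ∀ a ∈ s, ‖a‖ < 1)
    (r : Polynomial ℂ_[p]) (hr : r.degree < (Multiset.card s : ℕ))
    (hdom : ∀ x : ℂ_[p], ‖x‖ < 1 →
      ‖r.eval x‖ ≤ C * ‖((s.map fun a ↦ Polynomial.X - Polynomial.C a).prod).eval x‖) :
    r = 0 := by
  induction s using Multiset.induction_on generalizing r with
  | empty =>
    rw [Multiset.card_zero, Nat.cast_zero, Nat.WithBot.lt_zero_iff, Polynomial.degree_eq_bot] at hr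
    exact hr
  | cons a s ih =>
    have ha : ‖a‖ < 1 := hs a (Multiset.mem_cons_self a s)
    have hs' : ∀ b ∈ s, ‖b‖ < 1 := fun b hb ↦ hs b (Multiset.mem_cons_of_mem hb)
    set Q : Polynomial ℂ_[p] := (s.map fun a ↦ Polynomial.X - Polynomial.C a).prod with hQ
    have hprod : ((a ::ₘ s).map fun a ↦ Polynomial.X - Polynomial.C a).prod =
        (Polynomial.X - Polynomial.C a) * Q := by
      rw [Multiset.map_cons, Multiset.prod_cons]
    -- `r(a) = 0`
    have hra : r.IsRoot a := by
      have h := hdom a ha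
      rw [hprod, Polynomial.eval_mul, Polynomial.eval_sub, Polynomial.eval_X, Polynomial.eval_C,
        sub_self, zero_mul, norm_zero, mul_zero] at h
      exact norm_le_zero_iff.mp h
    obtain ⟨r₁, hr₁⟩ : (Polynomial.X - Polynomial.C a) ∣ r := Polynomial.dvd_iff_isRoot.mpr hra
    -- either `r₁ = 0` (done) or its degree drops by one
    by_cases hr₁0 : r₁ = 0
    · rw [hr₁, hr₁0, mul_zero]
    have hXa : (Polynomial.X - Polynomial.C a) ≠ 0 := Polynomial.X_sub_C_ne_zero a
    have hr0 : r ≠ 0 := by rw [hr₁]; exact mul_ne_zero hXa hr₁0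
    have hdeg₁ : r₁.degree < (Multiset.card s : ℕ) := by
      rw [← Polynomial.natDegree_lt_iff_degree_lt hr₁0]
      have h1 : r.natDegree < Multiset.card (a ::ₘ s) :=
        (Polynomial.natDegree_lt_iff_degree_lt hr0).mpr hr
      rw [Multiset.card_cons, hr₁, Polynomial.natDegree_mul hXa hr₁0, Polynomial.natDegree_X_sub_C]
        at h1
      omega
    -- domination of `r₁` off `a`, then at `a` by density
    have hdom₁' : ∀ x ∈ {x : ℂ_[p] | ‖x‖ < 1 ∧ x ∉ ({a} : Set ℂ_[p])},
        ‖r₁.eval x‖ ≤ C * ‖Q.eval x‖ := by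
      rintro x ⟨hx, hxa⟩
      have hxa' : x - a ≠ 0 := sub_ne_zero.mpr hxa
      have hpos : 0 < ‖x - a‖ := norm_pos_iff.mpr hxa'
      have h := hdom x hx
      rw [hprod, hr₁, Polynomial.eval_mul, Polynomial.eval_mul, Polynomial.eval_sub, Polynomial.eval_X,
        Polynomial.eval_C, norm_mul, norm_mul, ← mul_assoc, mul_comm C, mul_assoc] at h
      exact le_of_mul_le_mul_left h hpos
    have hdom₁ : ∀ x : ℂ_[p], ‖x‖ < 1 → ‖r₁.eval x‖ ≤ C * ‖Q.eval x‖ := fun x hx ↦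
      norm_eval_le_on_closure hdom₁' (mem_closure_disc_diff_finite (Set.finite_singleton a) hx)
    have h := ih hs' r₁ hdeg₁ hdom₁
    exact absurd h hr₁0

/-! ### §3 Divisibility up to `p^μ` in `R₀⟦T⟧` ⟺ pointwise norm domination on the open disc -/

/-- **Domination on a dense set of the disc ⟹ divisibility up to a power of `p`.** Let `g ≠ 0` and `L`
be elements of `Λ^ur = R₀⟦T⟧` and `S ⊆ ℂ_p` a set of points such that every point of the open unit disc
lies in the closure of `S ∩ {‖x‖ < 1}`. If `‖L(x)‖ ≤ C · ‖g(x)‖` for every `x ∈ S` with `‖x‖ < 1`, then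
`p^μ · L ∈ (g)` for some `μ : ℕ` (namely the `p`-content of `g`). Proof: `g = p^a · P · U` (`p`-content +
Weierstrass preparation over the complete DVR `R₀`), `L = (P U) q + r` with `deg r < deg P` (Weierstrass
division), `‖r(x)‖ ≤ (max C 0 + 1) · ‖P(x)‖` on `S`, hence on the disc, `P` splits over `ℂ_p` with all
roots in the disc, so `r = 0` (§2) and `p^a L = q · g`. [cite: Washington1997, §7.1 Prop. 7.2, Thm. 7.3] -/
theorem exists_C_pow_mul_mem_span_of_norm_value_le {g L : UnrSeries p} (hg : g ≠ 0) {S : Set ℂ_[p]}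
    (hS : ∀ x : ℂ_[p], ‖x‖ < 1 → x ∈ closure {y : ℂ_[p] | ‖y‖ < 1 ∧ y ∈ S}) {C : ℝ}
    (hdom : ∀ x ∈ S, ‖x‖ < 1 → ∀ u v : ℂ_[p], g.HasValueAt x u → L.HasValueAt x v → ‖v‖ ≤ C * ‖u‖) :
    ∃ μ : ℕ, PowerSeries.C (((p : ℕ) : unrIntegers p) ^ μ) * L ∈ Ideal.span {g} := by
  haveI := isDiscreteValuationRing_unrIntegers (p := p)
  haveI : IsAdicComplete (IsLocalRing.maximalIdeal (unrIntegers p)) (unrIntegers p) :=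
    isAdicComplete_maximalIdeal
  obtain ⟨a, g₀, hga, hg₀⟩ := UnrSeries.exists_eq_C_pow_mul_map_residue_ne_zero hg
  obtain ⟨P, U, H⟩ := g₀.exists_isWeierstrassFactorization hg₀
  obtain ⟨q, r, HD⟩ := L.exists_isWeierstrassDivision hg₀
  have hLeq : L = g₀ * q + (r : UnrSeries p) := HD.eq_mul_add
  have hdegr : r.degree < (P.natDegree : ℕ) := by rw [H.natDegree_eq_toNat_order_map]; exact HD.degree_lt
  set Pc : Polynomial ℂ_[p] := P.map (unrIntegers p).subtype with hPc
  set rc : Polynomial ℂ_[p] := r.map (unrIntegers p).subtype with hrc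
  have hinj : Function.Injective (unrIntegers p).subtype := Subtype.coe_injective
  have hPmo : Pc.Monic := H.isDistinguishedAt.monic.map _
  have hPdeg : Pc.natDegree = P.natDegree := Polynomial.natDegree_map_eq_of_injective hinj P
  have hrdeg : rc.degree = r.degree := Polynomial.degree_map_eq_of_injective hinj r
  -- norm of `p^a`
  have hpa : ‖((((p : ℕ) : unrIntegers p) ^ a : unrIntegers p) : ℂ_[p])‖ ≤ 1 :=
    norm_coe_unrIntegers_le_one p _
  -- STEP 1: `‖r(x)‖ ≤ C' ‖P(x)‖` on `S ∩ disc`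
  set C' : ℝ := max C 0 + 1 with hC'
  have hstep : ∀ x ∈ {y : ℂ_[p] | ‖y‖ < 1 ∧ y ∈ S}, ‖rc.eval x‖ ≤ C' * ‖Pc.eval x‖ := by
    rintro x ⟨hx, hxS⟩
    obtain ⟨u, hu⟩ := exists_hasValueAt U hx
    obtain ⟨w, hw⟩ := exists_hasValueAt q hx
    have hP : UnrSeries.HasValueAt (P : UnrSeries p) x (Pc.eval x) := hasValueAt_coe_polynomial P x
    have hr : UnrSeries.HasValueAt (r : UnrSeries p) x (rc.eval x) := hasValueAt_coe_polynomial r x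
    have hg₀v : UnrSeries.HasValueAt g₀ x (Pc.eval x * u) := by
      rw [H.eq_mul]; exact hasValueAt_mul hx hP hu
    have hgv : UnrSeries.HasValueAt g x
        (((((p : ℕ) : unrIntegers p) ^ a : unrIntegers p) : ℂ_[p]) * (Pc.eval x * u)) := by
      rw [hga]; exact hasValueAt_C_mul _ hg₀v
    have hLv : UnrSeries.HasValueAt L x (Pc.eval x * u * w + rc.eval x) := by
      rw [hLeq]; exact hasValueAt_add (hasValueAt_mul hx hg₀v hw) hr
    have hd := hdom x hxS hx _ _ hgv hLv
    have hu1 : ‖u‖ = 1 := norm_value_eq_one_of_isUnit H.isUnit hx hu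
    have hw1 : ‖w‖ ≤ 1 := norm_value_le_one hx hw
    have hgn : ‖((((p : ℕ) : unrIntegers p) ^ a : unrIntegers p) : ℂ_[p]) * (Pc.eval x * u)‖ ≤
        ‖Pc.eval x‖ := by
      rw [norm_mul, norm_mul, hu1, mul_one]
      exact mul_le_of_le_one_left (norm_nonneg _) hpa
    have h1 : ‖Pc.eval x * u * w + rc.eval x‖ ≤ max C 0 * ‖Pc.eval x‖ :=
      hd.trans ((mul_le_mul_of_nonneg_right (le_max_left C 0) (norm_nonneg _)).trans
        (mul_le_mul_of_nonneg_left hgn (le_max_right C 0)))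
    have h2 : ‖Pc.eval x * u * w‖ ≤ ‖Pc.eval x‖ := by
      rw [norm_mul, norm_mul, hu1, mul_one]
      exact mul_le_of_le_one_right (norm_nonneg _) hw1
    calc ‖rc.eval x‖ = ‖(Pc.eval x * u * w + rc.eval x) - Pc.eval x * u * w‖ := by
          rw [add_sub_cancel_left]
      _ ≤ ‖Pc.eval x * u * w + rc.eval x‖ + ‖Pc.eval x * u * w‖ := norm_sub_le _ _
      _ ≤ max C 0 * ‖Pc.eval x‖ + ‖Pc.eval x‖ := add_le_add h1 h2
      _ = C' * ‖Pc.eval x‖ := by rw [hC']; ring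
  -- STEP 2: extend to the whole disc by density
  have hdisc : ∀ x : ℂ_[p], ‖x‖ < 1 → ‖rc.eval x‖ ≤ C' * ‖Pc.eval x‖ := fun x hx ↦
    norm_eval_le_on_closure hstep (hS x hx)
  -- STEP 3: `Pc` splits with all roots in the disc; kill `rc`
  have hroots : Multiset.card Pc.roots = Pc.natDegree :=
    (IsAlgClosed.splits Pc).natDegree_eq_card_roots.symm
  have hPprod : (Pc.roots.map fun a ↦ Polynomial.X - Polynomial.C a).prod = Pc :=
    Polynomial.prod_multiset_X_sub_C_of_monic_of_roots_card_eq hPmo hroots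
  have hcoef : ∀ k < Pc.natDegree, ‖Pc.coeff k‖ < 1 := by
    intro k hk
    rw [hPc, Polynomial.coeff_map, Subring.subtype_apply]
    exact norm_lt_one_of_mem_maximalIdeal (H.isDistinguishedAt.mem (by rwa [hPdeg] at hk))
  have hrootsdisc : ∀ α ∈ Pc.roots, ‖α‖ < 1 := fun α hα ↦
    norm_root_lt_one hPmo hcoef ((Polynomial.mem_roots hPmo.ne_zero).mp hα)
  have hrc0 : rc = 0 := by
    refine eq_zero_of_norm_eval_le_prod (C := C') Pc.roots hrootsdisc rc ?_ ?_
    · rw [hroots, hPdeg, hrdeg]; exact hdegr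
    · intro x hx
      rw [hPprod]
      exact hdisc x hx
  have hr0 : r = 0 := (Polynomial.map_eq_zero_iff hinj).mp hrc0
  -- STEP 4: `p^a · L = q · g`
  refine ⟨a, Ideal.mem_span_singleton'.mpr ⟨q, ?_⟩⟩
  rw [hLeq, hr0, Polynomial.coe_zero, add_zero, hga]
  ring

/-- **The converse: divisibility up to `p^μ` ⟹ domination with constant `p^μ`.** If `p^μ · L = q · g` in
`R₀⟦T⟧` then `‖L(x)‖ ≤ p^μ · ‖g(x)‖` at every point of the open unit disc (`‖q(x)‖ ≤ 1`).
[cite: Washington1997, §7.1] -/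
theorem norm_value_le_of_C_pow_mul_mem_span {g L : UnrSeries p} {μ : ℕ}
    (h : PowerSeries.C (((p : ℕ) : unrIntegers p) ^ μ) * L ∈ Ideal.span {g}) {x u v : ℂ_[p]}
    (hx : ‖x‖ < 1) (hu : g.HasValueAt x u) (hv : L.HasValueAt x v) : ‖v‖ ≤ (p : ℝ) ^ μ * ‖u‖ := by
  obtain ⟨q, hq⟩ := Ideal.mem_span_singleton'.mp h
  obtain ⟨w, hw⟩ := exists_hasValueAt q hx
  have h1 : UnrSeries.HasValueAt (q * g) x (w * u) := hasValueAt_mul hx hw hu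
  have h2 : UnrSeries.HasValueAt (PowerSeries.C (((p : ℕ) : unrIntegers p) ^ μ) * L) x
      (((((p : ℕ) : unrIntegers p) ^ μ : unrIntegers p) : ℂ_[p]) * v) := hasValueAt_C_mul _ hv
  rw [hq] at h1
  have h3 : ((((p : ℕ) : unrIntegers p) ^ μ : unrIntegers p) : ℂ_[p]) * v = w * u := h2.unique h1
  have hw1 : ‖w‖ ≤ 1 := norm_value_le_one hx hw
  have hp0 : (0 : ℝ) < (p : ℝ) := by exact_mod_cast hp.out.pos
  have hn : ‖((((p : ℕ) : unrIntegers p) ^ μ : unrIntegers p) : ℂ_[p])‖ = ((p : ℝ)⁻¹) ^ μ :=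
    norm_coe_natCast_pow μ
  have h4 : ((p : ℝ)⁻¹) ^ μ * ‖v‖ ≤ ‖u‖ := by
    rw [← hn, ← norm_mul, h3, norm_mul]
    exact mul_le_of_le_one_left (norm_nonneg _) hw1
  calc ‖v‖ = (p : ℝ) ^ μ * (((p : ℝ)⁻¹) ^ μ * ‖v‖) := by
        rw [← mul_assoc, ← mul_pow, mul_inv_cancel₀ hp0.ne', one_pow, one_mul]
    _ ≤ (p : ℝ) ^ μ * ‖u‖ := mul_le_mul_of_nonneg_left h4 (by positivity)

/-- **Divisibility up to a power of `p` ⟺ uniform norm domination on the open disc.** For `g ≠ 0` and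
`L` in `Λ^ur = R₀⟦T⟧`: `∃ μ, p^μ · L ∈ (g)` iff `∃ C, ‖L(x)‖ ≤ C · ‖g(x)‖` for every `x ∈ ℂ_p` with
`‖x‖ < 1`. The right-hand side is the shape in which a specialisation-wise Kolyvagin-system bound is
delivered; the left-hand side is the shape of stub A / crux 26896. [cite: Washington1997, §7.1 Thm. 7.3] -/
theorem exists_C_pow_mul_mem_span_iff_norm_value_le {g L : UnrSeries p} (hg : g ≠ 0) :
    (∃ μ : ℕ, PowerSeries.C (((p : ℕ) : unrIntegers p) ^ μ) * L ∈ Ideal.span {g}) ↔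
      ∃ C : ℝ, ∀ x : ℂ_[p], ‖x‖ < 1 → ∀ u v : ℂ_[p], g.HasValueAt x u → L.HasValueAt x v →
        ‖v‖ ≤ C * ‖u‖ := by
  constructor
  · rintro ⟨μ, hμ⟩
    exact ⟨(p : ℝ) ^ μ, fun x hx u v hu hv ↦ norm_value_le_of_C_pow_mul_mem_span hμ hx hu hv⟩
  · rintro ⟨C, hC⟩
    refine exists_C_pow_mul_mem_span_of_norm_value_le hg (S := Set.univ) (fun x hx ↦ ?_) (C := C)
      fun x _ hx u v hu hv ↦ hC x hx u v hu hv
    exact subset_closure ⟨hx, Set.mem_univ x⟩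

/-- **Domination off a finite set suffices**: if `‖L(x)‖ ≤ C · ‖g(x)‖` at every point of the open unit
disc outside a finite set `F` (a Kolyvagin-system bound typically excludes finitely many specialisations),
then `p^μ · L ∈ (g)` for some `μ`. [cite: Washington1997, §7.1 Thm. 7.3] -/
theorem exists_C_pow_mul_mem_span_of_norm_value_le_of_finite {g L : UnrSeries p} (hg : g ≠ 0)
    {F : Set ℂ_[p]} (hF : F.Finite) {C : ℝ}
    (hdom : ∀ x : ℂ_[p], x ∉ F → ‖x‖ < 1 → ∀ u v : ℂ_[p], g.HasValueAt x u → L.HasValueAt x v →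
      ‖v‖ ≤ C * ‖u‖) :
    ∃ μ : ℕ, PowerSeries.C (((p : ℕ) : unrIntegers p) ^ μ) * L ∈ Ideal.span {g} :=
  exists_C_pow_mul_mem_span_of_norm_value_le hg (S := Fᶜ)
    (fun _ hx ↦ mem_closure_disc_diff_finite hF hx) fun x hxF hx u v hu hv ↦ hdom x hxF hx u v hu hv

/-- **Stub-A-shaped corollary** (the conclusion `∃ μ, span{p^μ · L} ≤ J` of crux 26896, for an ideal `J`
of `R₀⟦T⟧` containing a non-zero `g` — on the Leopoldt cell `J = (Ch_Λ X).map toUnr` is principal,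
stub B): pointwise domination of `L` by `g` off a finite set of the open disc gives it.
[cite: Washington1997, §7.1 Thm. 7.3] -/
theorem exists_span_pow_mul_le_of_norm_value_le {g L : UnrSeries p} (hg : g ≠ 0)
    {J : Ideal (UnrSeries p)} (hgJ : g ∈ J) {F : Set ℂ_[p]} (hF : F.Finite) {C : ℝ}
    (hdom : ∀ x : ℂ_[p], x ∉ F → ‖x‖ < 1 → ∀ u v : ℂ_[p], g.HasValueAt x u → L.HasValueAt x v →
      ‖v‖ ≤ C * ‖u‖) :
    ∃ μ : ℕ, Ideal.span {((p : ℕ) : UnrSeries p) ^ μ * L} ≤ J := by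
  obtain ⟨μ, hμ⟩ := exists_C_pow_mul_mem_span_of_norm_value_le_of_finite hg hF hdom
  refine ⟨μ, ?_⟩
  rw [Ideal.span_singleton_le_iff_mem]
  have heq : ((p : ℕ) : UnrSeries p) ^ μ * L = PowerSeries.C (((p : ℕ) : unrIntegers p) ^ μ) * L := by
    rw [map_pow, map_natCast]
  rw [heq]
  exact ((Ideal.span_singleton_le_iff_mem _).mpr hgJ) hμ

end Summit.BirchSwinnertonDyer.BirchSwinnertonDyer.Theorems.CumulativeHeegnerInclusionAtThreeUnrSeriesDomination

end
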